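import Summits.NavierStokesRegularity.FunctionalMining.SpectralMixtureCandidates
import Summits.NavierStokesRegularity.FunctionalMining.TopEigSaturatingKillNu
import HarnessLib

/-!
# FunctionalMining — K1-Q6 (a) meets LEMMA K: the dictionary's `hkill` hypothesis discharged by the
# scaling door, modulo the pen family

Search for candidate a priori estimates; no regularity claim. Cell `pub-nsfunc`, census-2 seat
(gen 41), staged as `pub-nsfunc-census-2/lean/lemmaK-B/v2/TopEigStrainMixRateLink.lean` (sha256
5bf56d18cef921e3) and filed verbatim by the prove seat (gen 24; declarations byte-identical).
Imports the dict seat's staged `SpectralMixtureCandidates.lean` (K1-Q6 typed: the mixtures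
`F_ε = Φ_q + ε Z_q`, the candidate law `TopEigStrainMixLaw q ε`, the rate exponent
`TopEigStrainMixRate q a`, and `TopEigStrainMixRate.pos_of_not_saturatingLawSup (hkill : ∀ κ, ¬
SaturatingLawSup Φ_q (2q−3) ((3q−3)/(2q−3)) κ) : TopEigStrainMixRate q a → 0 < a`) and this seat's
`TopEigSaturatingKillNu.lean` (LEMMA K in scaling form:
`not_topEigMoment_saturatingLawSup_of_family_of_scaling`). Refutation BOOKKEEPING for CANDIDATE a
priori inequalities; nothing about regularity; NO witness family is exhibited; no row verdict and no
dictionary number is a kernel theorem by this file.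

CONTENT. At the K0 exponents `σ = 2q − 3`, `γ = (3q − 3)/(2q − 3)` the scaling exponent of LEMMA K is
`θ = 1 + q/σ = 1 + (2q − 3)⁻¹ q > 0` for every real `q > 3/2` (`one_add_inv_twoq_sub_three_mul_pos`),
so a family with the door hypotheses (K-a)–(K-c) of `NoGo/TopEigSaturatingKill.lean` / `TopEigSaturatingKillNu.lean` hands the
dictionary its `hkill` hypothesis verbatim (`not_topEigMoment_saturatingLawSup_K0_of_family`,
`q > 3/2`, no condition on `γ`), whence — composed with the dict seat's bookkeeping, `q ≥ 2` where
`Z_q` is differentiable along solutions — (i) `¬ TopEigStrainMixLaw q 0`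
(`not_topEigStrainMixLaw_zero_of_family`, `q > 3/2`), (ii) along every sequence `εₙ → 0` no single
`κ` serves all the mixtures `F_{εₙ}` (`exists_not_topEigStrainMixLaw_of_family`), (iii) every rate
exponent of escape (a) is positive: `TopEigStrainMixRate q a → 0 < a`
(`TopEigStrainMixRate.pos_of_family`). [ours, bookkeeping; K1-Q6 (a) × QN4-NOTE LEMMA K]
-/

noncomputable section

open MeasureTheory Set Filter Topology

namespace Summit.NavierStokesRegularity.FunctionalMining

open Literature.Analysis.FunctionSpaces Literature.Analysis.FluidPDE TopEig

/-- The scaling exponent of LEMMA K at the K0 exponents: `0 < 1 + (2q − 3)⁻¹ · q` for `q > 3/2`.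
[ours, bookkeeping] -/
theorem one_add_inv_twoq_sub_three_mul_pos {q : ℝ} (hq : 3 / 2 < q) : 0 < 1 + (2 * q - 3)⁻¹ * q := by
  have hσ : 0 < 2 * q - 3 := by linarith
  have h : 0 < (2 * q - 3)⁻¹ * q := mul_pos (inv_pos.mpr hσ) (by linarith)
  linarith

section K1Q6Link

variable {ι : Type*}

/-- **The dictionary's `hkill` from the family (K0 exponents, scaling form).** For real `q > 3/2`, a
family of smooth divergence-free zero-mean data on `T³` with heat-maximal selections, a production
floor `0 < c ≤ 𝒫_q`, budgets `(2ℰ)Φ_q^{1+(2q−3)⁻¹} ≤ B` and heat costs `≤ ε` for every `ε > 0` gives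
`∀ κ, ¬ SaturatingLawSup Φ_q (2q−3) ((3q−3)/(2q−3)) κ` — the hypothesis `hkill` of the dict seat's
`TopEigStrainMixRate.pos_of_not_saturatingLawSup`, verbatim. [ours, bookkeeping] -/
theorem not_topEigMoment_saturatingLawSup_K0_of_family {q c B : ℝ} (hq : 3 / 2 < q) (hc : 0 < c)
    {w : ι → UnitAddTorus (Fin 3) → EuclideanSpace ℝ (Fin 3)} {e : ι → UnitAddTorus (Fin 3) → Fin 3 → ℝ}
    (hw : ∀ i, Torus.IsSmooth (w i)) (hdw : ∀ i, Torus.IsDivFree (w i))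
    (hmean : ∀ i, Torus.HasZeroMean (w i)) (he : ∀ i, IsHeatMaxSelection (w i) (e i))
    (hint : ∀ i, Integrable (fun x => q * torusStrainTopEig (w i) x ^ (q - 1) *
      quad (eulerStrainVec (w i) x) (e i x)) volume)
    (hprod : ∀ i, c ≤ selEulerProduction q (w i) (e i))
    (hbud : ∀ i, 2 * torusEnstrophy (w i) * torusTopEigMoment q (w i) ^ (1 + (2 * q - 3)⁻¹) ≤ B)
    (hheat : ∀ ε : ℝ, 0 < ε → ∃ i, heatDissipation (torusTopEigMoment q) (w i) ≤ ε) (κ : ℝ) :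
    ¬ SaturatingLawSup (d := Fin 3) (torusTopEigMoment q) (2 * q - 3) ((3 * q - 3) / (2 * q - 3)) κ :=
  not_topEigMoment_saturatingLawSup_of_family_of_scaling (by linarith)
    (one_add_inv_twoq_sub_three_mul_pos hq) hc hw hdw hmean he hint hprod hbud hheat κ

/-- **Level `0` of K1-Q6 (a) fails, from the family** (`q > 3/2`): `¬ TopEigStrainMixLaw q 0`.
[ours, bookkeeping] -/
theorem not_topEigStrainMixLaw_zero_of_family {q c B : ℝ} (hq : 3 / 2 < q) (hc : 0 < c)
    {w : ι → UnitAddTorus (Fin 3) → EuclideanSpace ℝ (Fin 3)} {e : ι → UnitAddTorus (Fin 3) → Fin 3 → ℝ}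
    (hw : ∀ i, Torus.IsSmooth (w i)) (hdw : ∀ i, Torus.IsDivFree (w i))
    (hmean : ∀ i, Torus.HasZeroMean (w i)) (he : ∀ i, IsHeatMaxSelection (w i) (e i))
    (hint : ∀ i, Integrable (fun x => q * torusStrainTopEig (w i) x ^ (q - 1) *
      quad (eulerStrainVec (w i) x) (e i x)) volume)
    (hprod : ∀ i, c ≤ selEulerProduction q (w i) (e i))
    (hbud : ∀ i, 2 * torusEnstrophy (w i) * torusTopEigMoment q (w i) ^ (1 + (2 * q - 3)⁻¹) ≤ B)
    (hheat : ∀ ε : ℝ, 0 < ε → ∃ i, heatDissipation (torusTopEigMoment q) (w i) ≤ ε) :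
    ¬ TopEigStrainMixLaw (d := Fin 3) q 0 := by
  rw [topEigStrainMixLaw_zero_iff]
  rintro ⟨κ, hκ⟩
  exact not_topEigMoment_saturatingLawSup_K0_of_family hq hc hw hdw hmean he hint hprod hbud hheat κ hκ

/-- **No bounded constant for the mixtures, from the family** (`q ≥ 2`): along every sequence
`εₙ → 0` and for every `κ`, some mixture `F_{εₙ}` violates the law with constant `κ`.
[ours, bookkeeping] -/
theorem exists_not_topEigStrainMixLaw_of_family {q c B : ℝ} (hq : 2 ≤ q) (hc : 0 < c)
    {w : ι → UnitAddTorus (Fin 3) → EuclideanSpace ℝ (Fin 3)} {e : ι → UnitAddTorus (Fin 3) → Fin 3 → ℝ}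
    (hw : ∀ i, Torus.IsSmooth (w i)) (hdw : ∀ i, Torus.IsDivFree (w i))
    (hmean : ∀ i, Torus.HasZeroMean (w i)) (he : ∀ i, IsHeatMaxSelection (w i) (e i))
    (hint : ∀ i, Integrable (fun x => q * torusStrainTopEig (w i) x ^ (q - 1) *
      quad (eulerStrainVec (w i) x) (e i x)) volume)
    (hprod : ∀ i, c ≤ selEulerProduction q (w i) (e i))
    (hbud : ∀ i, 2 * torusEnstrophy (w i) * torusTopEigMoment q (w i) ^ (1 + (2 * q - 3)⁻¹) ≤ B)
    (hheat : ∀ ε : ℝ, 0 < ε → ∃ i, heatDissipation (torusTopEigMoment q) (w i) ≤ ε)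
    (κ : ℝ) {ε : ℕ → ℝ} (hε : Tendsto ε atTop (𝓝 0)) :
    ∃ n, ¬ SaturatingLawSup (d := Fin 3) (topEigStrainMix q (ε n)) (2 * q - 3)
      ((3 * q - 3) / (2 * q - 3)) κ :=
  exists_not_topEigStrainMixLaw_of_not_saturatingLawSup hq
    (not_topEigMoment_saturatingLawSup_K0_of_family (by linarith) hc hw hdw hmean he hint hprod hbud
      hheat) κ hε

/-- **K1-Q6 (a): the rate exponent is positive, from the family** (`q ≥ 2`):
`TopEigStrainMixRate q a → 0 < a`. The dict seat's `TopEigStrainMixRate.pos_of_not_saturatingLawSup`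
with its hypothesis `hkill` supplied by LEMMA K in scaling form. [ours, bookkeeping] -/
theorem TopEigStrainMixRate.pos_of_family {q a c B : ℝ} (hq : 2 ≤ q) (hc : 0 < c)
    {w : ι → UnitAddTorus (Fin 3) → EuclideanSpace ℝ (Fin 3)} {e : ι → UnitAddTorus (Fin 3) → Fin 3 → ℝ}
    (hw : ∀ i, Torus.IsSmooth (w i)) (hdw : ∀ i, Torus.IsDivFree (w i))
    (hmean : ∀ i, Torus.HasZeroMean (w i)) (he : ∀ i, IsHeatMaxSelection (w i) (e i))
    (hint : ∀ i, Integrable (fun x => q * torusStrainTopEig (w i) x ^ (q - 1) *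
      quad (eulerStrainVec (w i) x) (e i x)) volume)
    (hprod : ∀ i, c ≤ selEulerProduction q (w i) (e i))
    (hbud : ∀ i, 2 * torusEnstrophy (w i) * torusTopEigMoment q (w i) ^ (1 + (2 * q - 3)⁻¹) ≤ B)
    (hheat : ∀ ε : ℝ, 0 < ε → ∃ i, heatDissipation (torusTopEigMoment q) (w i) ≤ ε)
    (h : TopEigStrainMixRate (d := Fin 3) q a) : 0 < a :=
  h.pos_of_not_saturatingLawSup hq
    (not_topEigMoment_saturatingLawSup_K0_of_family (by linarith) hc hw hdw hmean he hint hprod hbud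
      hheat)

end K1Q6Link

end Summit.NavierStokesRegularity.FunctionalMining

end
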